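import Summits.ResolutionOfSingularities.ResolutionOfSingularities.Theorems.PurelyInseparableDim4SwapTransportWindowCoreAnyPrime
import Summits.ResolutionOfSingularities.ResolutionOfSingularities.Theorems.PurelyInseparableDim4ResConeCInfSharpLookAheadPrime
import Summits.ResolutionOfSingularities.ResolutionOfSingularities.Theorems.PurelyInseparableDim4ResConeCInfPinningPrime
import Summits.ResolutionOfSingularities.ResolutionOfSingularities.Theorems.PurelyInseparableDim4SwapTransportWindowGlue
import HarnessLib
import HarnessLib.Audit.Tags

/-!
# Purely inseparable four-folds — THE ♯-VIRTUAL STEP, CORE FORM, FOR EVERY PRIME: the translated virtual child of a ♯-framed state is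
# PURE (look-ahead through the next real step) and ♯-framed again (cell `res-dim4-pi`, K2(p) lane, rung-1 POWER-CONE LINE «light pair of
# TAIL(p, p−1, 3) ∀ p», flagless branch, FILE ♯7 part S♯a; seat res-dim4-typ-1 g6)

[OURS · counted 0 · cell `res-dim4-pi` · K2(p) lane (holder res-dim4-p-12 g5, rulings g5-23 / g5-27); res-dim4-p-3 g6's MEMO FLAGLESS♯ and
port plan §6 (♯7 = the ♯-window), res-dim4-typ-1 g6's design note (bus 2026-08-29 14:20Z).]  Nothing here proves K2(p) for any `p`, any
TAIL(p, p−1, 3), FLAGLESS♯, `NoIsolatedTrap p p`, the Cossart–Jannsen–Saito theorem or resolution of singularities in dimension ≥ 4 /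
characteristic `p` — NOT proved.  AI kernel work, weaker than expert review.  Transport bookkeeping about OUR frame; kills nothing by itself.

THE ♯-FRAME at jet `N` and ROW `c` (`c + 3 ≤ d`) of a virtual state `B` (slots `j, i`, free `u`, contact `f`; `d + 1 = p`): order `d + 2`,
`r = x_j x_i ∣ F`, `resForm = a·x_f^d` (`a ≠ 0`) and its support dress, EXACT LEDGER, REGIME R in both slots, LAYER, the dead ROW
`(u, f) = (d − 3 − c, c)` below `N`, the row's ♯-FLAG `coeff_{x_j³x_i³x_u^{d−2−c}x_f^c} F ≠ 0`, isolated, `e_G = 3`.  THE PINNING ENTERS BY VALUE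
(holder g5-26): one closed hypothesis `hVT` («framed parent, child's LAYER entry at the row dead ⇒ no `u`-translation»), for both slot
orientations; its `c = 0` instance is ♯1 `coeff_sharp_step_translate_u`, its row-`c` instance res-dim4-p-3's `coeff_level_step_translate_u`
at level `2` — discharged once by the assembler, never imported here.
**`virtual_step_sharp_of_core_prime`** — INPUT: a ♯-framed `B` (`N ≥ d + 5`); the TRANSLATED virtual child `B′ = step p univ j b′ B`
(`b′ j = b′ i = 0`) that C♯ `virtual_core_any_prime` returned, related along `π′` to the real child `A′` at precision `M′`, of order `d + 2`,
isolated, `e_G = 3`; and ONE MORE honest real step `A″ = step p univ jr₂ b₂ A′` in regime (isolated with certificate `Nc`, order `d + 2`,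
`e_G = 3`, weights `≤ 1` of degree `2`, `x^r ∣`), `Nc + 2p + 2 ≤ M′`.  OUTPUT: **`b′ = 0`** and the ♯-frame of the PURE child
`step p univ j 0 B` at jet `N − d`.  ROUTE: W2 (VT-f) kills `b′ f`; C♯ once more gives the translated virtual grandchild with its regime;
(VT-f) again; LA♯ `layer_of_lookahead_prime` gives LAYER of the child and `hVT` gives `b′ u = 0`; the rest of the frame by TS
`translated_child_frame_prime` (β = 0), ♯2b `three_le_apply_of_layer_step_translate_u` / `le_apply_of_step_translate_other`,
`row_step_zero_prime` (row `(d−3−c, c)`), and the chart law for the ♯-flag (`x_j²x_i²u^{d−2−c}x_f^c` is a fixed point of the corner map).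
The `i`-slot edition is this statement with `j ↔ i`.
[cite: Hauser2010, §§F–G] [cite: CossartJannsenSaito2020, Thm. 3.14, Lemma 13.2]
bears_on: LADDER-RESOLUTION:D157-DOOR2 (res-dim4-pi · K2(p) · power cones · flagless branch ♯7 ♯-virtual step, core form).  Supports
stmt-ResolutionOfSingularities-16155 (helper).
-/

set_option linter.dupNamespace false -- mandated namespace of this single-conjunct summit

noncomputable section

namespace Summit.ResolutionOfSingularities.ResolutionOfSingularities.Theorems.PIDim4

namespace SwapTransport

open MvPolynomial Finset
open Literature.AlgebraicGeometry.Resolution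
open Literature.AlgebraicGeometry.Resolution.CentreBlowup
open Literature.AlgebraicGeometry.Resolution.Hauser2010
open Literature.AlgebraicGeometry.Resolution.HauserPerlega2019

variable {K : Type} [Field K] [DecidableEq K]

/-- **THE ♯-VIRTUAL STEP, CORE FORM, every prime** (module docstring). [OURS] [cite: Hauser2010, §§F–G]
[cite: CossartJannsenSaito2020, Thm. 3.14, Lemma 13.2] -/
theorem virtual_step_sharp_of_core_prime (p : ℕ) [Fact p.Prime] [CharP K p] {d c : ℕ} (hdp : d + 1 = p) (hc : c + 3 ≤ d)
    {j i u f : Fin 4} (hji : j ≠ i) (hju : j ≠ u) (hjf : j ≠ f) (hiu : i ≠ u) (hif : i ≠ f) (huf : u ≠ f)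
    -- the pinning at the row `c`, BY VALUE (holder g5-26): for both slot orientations `(x, y)`
    (hVT : ∀ (x y : Fin 4) (B : State K) (β : K), x ≠ y → x ≠ u → x ≠ f → y ≠ u → y ≠ f →
      ordZero B.F = ((d + 2 : ℕ) : ℕ∞) → (∀ e ∈ B.F.support, e f = c → 3 ≤ e x) →
      coeff (Finsupp.single x 4 + Finsupp.single y 3 + Finsupp.single u (d - 3 - c) + Finsupp.single f c) B.F = 0 →
      coeff (Finsupp.single x 3 + Finsupp.single y 3 + Finsupp.single u (d - 2 - c) + Finsupp.single f c) B.F ≠ 0 →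
      coeff (Finsupp.single x 3 + Finsupp.single y 3 + Finsupp.single u (d - 3 - c) + Finsupp.single f c)
        (CentreBlowup.step p Finset.univ x (Function.update (0 : Fin 4 → K) u β) B).F = 0 → β = 0)
    {π' : Equiv.Perm (Fin 4)} {A' B : State K} {M' N Nc : ℕ}
    -- the ♯-frame of the virtual parent
    (hoB : ordZero B.F = ((d + 2 : ℕ) : ℕ∞)) (hrB : B.r = Finsupp.single j 1 + Finsupp.single i 1)
    (hdivB : ∀ e ∈ B.F.support, B.r ≤ e) {a : K} (ha : a ≠ 0) (hformB : ResCone.resForm B = C a * X f ^ d)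
    (hstrB : ∀ e ∈ B.F.support, e.degree = d + 2 →
      e = Finsupp.single j 1 + Finsupp.single i 1 + Finsupp.single u 0 + Finsupp.single f d)
    (hledB : ∀ e ∈ B.F.support, e f ≤ d - 1 → 2 ≤ e j ∧ 2 ≤ e i)
    (hRj : ∀ e ∈ B.F.support, e f + 2 ≤ d → 3 ≤ e j) (hRi : ∀ e ∈ B.F.support, e f + 2 ≤ d → 3 ≤ e i)
    (hlayerB : ∀ E : Fin 4 →₀ ℕ, E.degree = d + 3 → E f + 2 ≤ d → coeff E B.F = 0)
    (hN : d + 5 ≤ N) (hrowB : ∀ e ∈ B.F.support, e.degree < N → ¬ (e u = d - 3 - c ∧ e f = c))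
    (hg : coeff (Finsupp.single j 3 + Finsupp.single i 3 + Finsupp.single u (d - 2 - c) + Finsupp.single f c) B.F ≠ 0)
    -- the translated virtual child of C♯, related to the real child `A′`
    {b' : Fin 4 → K} (hb'j : b' j = 0) (hb'i : b' i = 0)
    (hrel' : ∃ (θ e : Fin 4 → MvPolynomial (Fin 4) K) (U E : MvPolynomial (Fin 4) K),
      θ (π' j) = X j * e j ∧ θ (π' i) = X i * e i ∧ constantCoeff (e j) ≠ 0 ∧ constantCoeff (e i) ≠ 0 ∧
      constantCoeff (θ (π' u)) = 0 ∧ constantCoeff (θ (π' f)) = 0 ∧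
      coeff (Finsupp.single u 1) (θ (π' u)) * coeff (Finsupp.single f 1) (θ (π' f)) -
        coeff (Finsupp.single f 1) (θ (π' u)) * coeff (Finsupp.single u 1) (θ (π' f)) ≠ 0 ∧
      constantCoeff U ≠ 0 ∧ E ∈ originIdeal K ^ M' ∧
      (CentreBlowup.step p Finset.univ j b' B).F = deletePthPowers p (U ^ p * aeval θ A'.F) + E)
    (hrA' : A'.r = Finsupp.single (π' j) 1 + Finsupp.single (π' i) 1) (hoA' : ordZero A'.F = ((d + 2 : ℕ) : ℕ∞))
    (ho' : ordZero (CentreBlowup.step p Finset.univ j b' B).F = ((d + 2 : ℕ) : ℕ∞))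
    (he3' : Module.finrank K (ResCone.resVertex (CentreBlowup.step p Finset.univ j b' B)) = 3)
    (hiso' : IsIsolated p (CentreBlowup.step p Finset.univ j b' B).F)
    -- one more honest real step, in regime
    {jr₂ : Fin 4} {b₂ : Fin 4 → K} (hbj₂ : b₂ jr₂ = 0) {A'' : State K} (hstep₂ : A'' = CentreBlowup.step p Finset.univ jr₂ b₂ A')
    (hisoA'' : IsIsolated p A''.F) (hcert'' : originIdeal K ^ Nc ≤ singLocusIdeal p A''.F ⊔ originIdeal K ^ (Nc + 1))
    (hoA'' : ordZero A''.F = ((d + 2 : ℕ) : ℕ∞)) (he3A'' : Module.finrank K (ResCone.resVertex A'') = 3)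
    (hw1'' : ∀ k, A''.r k ≤ 1) (hdegA'' : A''.r.degree = 2) (hdivA'' : ∀ e ∈ A''.F.support, A''.r ≤ e) (hM' : Nc + 2 * p + 2 ≤ M') :
    b' = 0 ∧
      (ordZero (CentreBlowup.step p Finset.univ j 0 B).F = ((d + 2 : ℕ) : ℕ∞) ∧
        (CentreBlowup.step p Finset.univ j 0 B).r = Finsupp.single j 1 + Finsupp.single i 1 ∧
        (∀ e ∈ (CentreBlowup.step p Finset.univ j 0 B).F.support, (CentreBlowup.step p Finset.univ j 0 B).r ≤ e) ∧
        (∃ a' : K, a' ≠ 0 ∧ ResCone.resForm (CentreBlowup.step p Finset.univ j 0 B) = C a' * X f ^ d) ∧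
        (∀ e ∈ (CentreBlowup.step p Finset.univ j 0 B).F.support, e.degree = d + 2 →
          e = Finsupp.single j 1 + Finsupp.single i 1 + Finsupp.single u 0 + Finsupp.single f d) ∧
        (∀ e ∈ (CentreBlowup.step p Finset.univ j 0 B).F.support, e f ≤ d - 1 → 2 ≤ e j ∧ 2 ≤ e i) ∧
        (∀ e ∈ (CentreBlowup.step p Finset.univ j 0 B).F.support, e f + 2 ≤ d → 3 ≤ e j) ∧
        (∀ e ∈ (CentreBlowup.step p Finset.univ j 0 B).F.support, e f + 2 ≤ d → 3 ≤ e i) ∧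
        (∀ E : Fin 4 →₀ ℕ, E.degree = d + 3 → E f + 2 ≤ d → coeff E (CentreBlowup.step p Finset.univ j 0 B).F = 0) ∧
        (∀ e ∈ (CentreBlowup.step p Finset.univ j 0 B).F.support, e.degree < N - d → ¬ (e u = d - 3 - c ∧ e f = c)) ∧
        coeff (Finsupp.single j 3 + Finsupp.single i 3 + Finsupp.single u (d - 2 - c) + Finsupp.single f c)
          (CentreBlowup.step p Finset.univ j 0 B).F ≠ 0 ∧
        IsIsolated p (CentreBlowup.step p Finset.univ j 0 B).F ∧
        Module.finrank K (ResCone.resVertex (CentreBlowup.step p Finset.univ j 0 B)) = 3) := by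
  classical
  have hp : p.Prime := Fact.out
  have hd2 : 2 ≤ d := by omega
  have hdp2 : d + 2 = p + 1 := by omega
  have hq : ((p : ℕ) : ℕ∞) ≤ ordAlong Finset.univ B.F := by
    rw [ordAlong_univ, hoB]; exact_mod_cast (by omega : p ≤ d + 2)
  have h6 : ∀ e ∈ B.F.support, d + 2 ≤ e.degree := fun e he => ResCone.le_degree_of_mem_support_of_ordZero hoB he
  have hrj : B.r j = 1 := by rw [hrB]; simp [hji]
  have hri : B.r i = 1 := by rw [hrB]; simp [hji.symm]
  have hrdeg : B.r.degree = 2 := by rw [hrB, map_add, Finsupp.degree_single, Finsupp.degree_single]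
  -- (VT-f): the translation has no contact component, hence `b′ = β·e_u`
  have hin : initialForm B.F = monomial (Finsupp.single j 1 + Finsupp.single i 1 + Finsupp.single f d) a := by
    rw [← ResCone.monomial_mul_resForm hdivB, hformB, hrB, X_pow_eq_monomial, C_mul_monomial, mul_one, monomial_mul, one_mul]
  have hb'f : b' f = 0 := ResCone.cInf_translation_contact_eq_zero_prime p hdp hji.symm hjf.symm hif.symm hoB ha hin hb'j hb'i ho'
  set β := b' u with hβ
  have hb'eq : b' = Function.update (0 : Fin 4 → K) u β := eq_single_of_letters hji hju hjf hiu hif huf hb'j hb'i hb'f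
  rw [hb'eq] at hrel' ho' he3' hiso'
  -- the translated child is framed (TS)
  obtain ⟨hr₁, hdiv₁, hled₁, ⟨a₁, ha₁, hform₁⟩, hstr₁⟩ :=
    ResCone.translated_child_frame_prime hji hju hjf hiu hif huf p hdp hd2 hrB hdivB hoB hstrB hledB β ho' he3'
  -- C♯ once more: the translated virtual grandchild, in regime
  have hoA'1 : ordZero A'.F = ((p + 1 : ℕ) : ℕ∞) := by rw [hoA', hdp2]
  have ho'1 : ordZero (CentreBlowup.step p Finset.univ j (Function.update (0 : Fin 4 → K) u β) B).F = ((p + 1 : ℕ) : ℕ∞) := by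
    rw [ho', hdp2]
  have hoA''1 : ordZero A''.F = ((p + 1 : ℕ) : ℕ∞) := by rw [hoA'', hdp2]
  obtain ⟨ℓ₂, -, b'', hℓ₂, -, -, hb''j, hb''i, -, -, ho₂, hr₂, hdiv₂, -, he3₂⟩ :=
    virtual_core_any_prime p hji hju hjf hiu hif huf hrel' hrA' hoA'1 ho'1 hr₁ hdiv₁ hbj₂ hstep₂ hisoA'' hcert'' hoA''1 he3A'' hw1''
      hdegA'' hdivA'' hM'
  rw [← hdp2] at ho₂
  -- (VT-f) at the child, in the chart `ℓ₂`
  have hb''f : b'' f = 0 := by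
    rcases hℓ₂ with rfl | rfl
    · have hin₁ : initialForm (CentreBlowup.step p Finset.univ ℓ₂ (Function.update (0 : Fin 4 → K) u β) B).F =
          monomial (Finsupp.single ℓ₂ 1 + Finsupp.single i 1 + Finsupp.single f d) a₁ := by
        rw [← ResCone.monomial_mul_resForm hdiv₁, hform₁, hr₁, X_pow_eq_monomial, C_mul_monomial, mul_one, monomial_mul, one_mul]
      exact ResCone.cInf_translation_contact_eq_zero_prime p hdp hji.symm hjf.symm hif.symm ho' ha₁ hin₁ hb''j hb''i ho₂
    · have hin₁ : initialForm (CentreBlowup.step p Finset.univ j (Function.update (0 : Fin 4 → K) u β) B).F =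
          monomial (Finsupp.single ℓ₂ 1 + Finsupp.single j 1 + Finsupp.single f d) a₁ := by
        rw [← ResCone.monomial_mul_resForm hdiv₁, hform₁, hr₁, X_pow_eq_monomial, C_mul_monomial, mul_one, monomial_mul, one_mul,
          add_comm (Finsupp.single j 1) (Finsupp.single ℓ₂ 1)]
      exact ResCone.cInf_translation_contact_eq_zero_prime p hdp hji hif.symm hjf.symm ho' ha₁ hin₁ hb''i hb''j ho₂
  set β' := b'' u with hβ'
  have hb''eq : b'' = Function.update (0 : Fin 4 → K) u β' := eq_single_of_letters hji hju hjf hiu hif huf hb''j hb''i hb''f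
  rw [hb''eq] at ho₂ he3₂
  -- LA♯: the look-ahead LAYER of the child; then the pinning, by value
  have hlayer₁ := ResCone.layer_of_lookahead_prime hji hju hjf hiu hif huf p hdp hd2 hrB hdivB hoB hstrB hledB hRi hlayerB β ho' he3'
    hℓ₂ β' ho₂ he3₂
  have hcross : coeff (Finsupp.single j 4 + Finsupp.single i 3 + Finsupp.single u (d - 3 - c) + Finsupp.single f c) B.F = 0 := by
    by_contra hne
    obtain ⟨-, -, hu3, hfc⟩ := ResCone.quad_apply hji hju hjf hiu hif huf 4 3 (d - 3 - c) c
    refine hrowB _ (mem_support_iff.mpr hne) ?_ ⟨hu3, hfc⟩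
    simp only [map_add, Finsupp.degree_single]; omega
  have hdeg3 : (Finsupp.single j 3 + Finsupp.single i 3 + Finsupp.single u (d - 3 - c) + Finsupp.single f c : Fin 4 →₀ ℕ).degree =
      d + 3 := by
    simp only [map_add, Finsupp.degree_single]; omega
  have hβ0 : β = 0 := hVT j i B β hji hju hjf hiu hif hoB (fun e he hf => hRj e he (by omega)) hcross hg
    (hlayer₁ _ hdeg3 (by rw [(ResCone.quad_apply hji hju hjf hiu hif huf 3 3 (d - 3 - c) c).2.2.2]; omega))
  have hupd0 : Function.update (0 : Fin 4 → K) u (0 : K) = 0 := Function.update_eq_self u (0 : Fin 4 → K)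
  have hupd : Function.update (0 : Fin 4 → K) u β = 0 := by rw [hβ0]; exact hupd0
  refine ⟨by rw [hb'eq, hupd], ?_⟩
  -- the ♯-frame of the pure child
  rw [hupd] at ho' he3' hiso' hr₁ hdiv₁ hled₁ hform₁ hstr₁ hlayer₁
  -- regime R: the `j`-slot from the LAYER parent, the `i`-slot kept
  have hRj' := ResCone.three_le_apply_of_layer_step_translate_u hji hju hjf hiu hif huf p hdp B hq h6 hstrB hlayerB 0
  have hRi' := ResCone.le_apply_of_step_translate_other hji.symm hiu hif hju hjf huf p B hq hRi (0 : K)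
  rw [hupd0] at hRj' hRi'
  -- the row
  have hrow' := ResCone.row_step_zero_prime hji hju hjf hiu hif huf p hdp B (fun e he => by have h := hdivB e he i; rwa [hri] at h)
    (fun e he => by have := h6 e he; omega) hrowB
  -- the ♯-flag is carried: `x_j²x_i²u^{d−2}` is a fixed point of the corner map in the chart `j`
  set m : Fin 4 →₀ ℕ := Finsupp.single j 2 + Finsupp.single i 2 + Finsupp.single u (d - 2 - c) + Finsupp.single f c with hm
  obtain ⟨hmj, hmi, -, -⟩ := ResCone.quad_apply hji hju hjf hiu hif huf 2 2 (d - 2 - c) c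
  have hmdeg : m.degree = d + 2 := by simp only [hm, map_add, Finsupp.degree_single]; omega
  have hshift : (Finsupp.single j 3 + Finsupp.single i 3 + Finsupp.single u (d - 2 - c) + Finsupp.single f c : Fin 4 →₀ ℕ) =
      B.r + m := by
    rw [hrB, hm, show (Finsupp.single j 3 : Fin 4 →₀ ℕ) = Finsupp.single j 1 + Finsupp.single j 2 by rw [← Finsupp.single_add],
      show (Finsupp.single i 3 : Fin 4 →₀ ℕ) = Finsupp.single i 1 + Finsupp.single i 2 by rw [← Finsupp.single_add]]
    abel
  have hg' : coeff (Finsupp.single j 3 + Finsupp.single i 3 + Finsupp.single u (d - 2 - c) + Finsupp.single f c)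
      (CentreBlowup.step p Finset.univ j 0 B).F ≠ 0 := by
    have hmj' : m j = 2 := hmj
    have hupdm : m.update j (m.degree - d) = m := by
      rw [show m.degree - d = m j by rw [hmdeg, hmj']; omega]; exact Finsupp.update_self m j
    have hchart : coeff (B.r + m.update j (m.degree - d)) (CentreBlowup.step p Finset.univ j 0 B).F = coeff (B.r + m) B.F := by
      rw [← ResCone.chartExponent_pair_add_of_succ p hdp hji hrB (by omega : d ≤ m.degree),
        ResCone.coeff_step_zero_chartExponent p j B hq (by rw [map_add, hrdeg]; omega),
        if_neg (ResCone.not_isPthPowerExponent_of_not_dvd (i := i) ?_)]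
      rw [ResCone.chartExponent_pair_add_of_succ p hdp hji hrB (by omega : d ≤ m.degree), Finsupp.add_apply, hri, Finsupp.coe_update,
        Function.update_of_ne hji.symm, hmi]
      intro hdvd
      have := Nat.le_of_dvd (by omega) hdvd
      omega
    rw [hupdm] at hchart
    rw [hshift, hchart, ← hshift]
    exact hg
  exact ⟨ho', hr₁, hdiv₁, ⟨a₁, ha₁, hform₁⟩, hstr₁, hled₁, hRj', hRi', hlayer₁, hrow', hg', hiso', he3'⟩

end SwapTransport

end Summit.ResolutionOfSingularities.ResolutionOfSingularities.Theorems.PIDim4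

end
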